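import Literature.AlgebraicGeometry.Modules.AffineLocalizing
import Literature.Algebra.Homology.CartanCriterion
import Literature.Algebra.Homology.CechFiniteFamily
import Literature.Algebra.Homology.CechLocalization
import Mathlib.CategoryTheory.Abelian.GrothendieckCategory.HasExt
import Mathlib.Topology.Sheaves.Abelian
import HarnessLib

/-!
# Serre's vanishing theorem on affine opens: `Hᵖ(V, M) = 0` for `p > 0`, `M` quasi-coherent
# (The Stacks Project, Tag 01XB; Görtz–Wedhorn II, Thm. 22.2; Hartshorne III, Thm. 3.5)

For a scheme `X`, a sheaf of `𝒪_X`-modules `M : X.Modules` which is affine-localizing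
(`Modules/AffineLocalizing`: numerators and torsion on the principal opens of affine opens — e.g.
QUASI-COHERENT, `IsAffineLocalizing.of_isQuasicoherent`) and an AFFINE open `V ⊆ X`, the higher
cohomology of `V` with coefficients in (the abelian sheaf underlying) `M` vanishes:

* `subsingleton_ext_freeSheaf_of_isAffineOpen` — **`Hᵖ(V, M) := Extᵖ(ℤ[h_V], M) = 0` for all
  `p > 0`** (cohomology of the open `V` computed on the site `Opens X`, as in
  `Algebra/Homology/CartanCriterion`; `ℤ[h_V] = freeSheaf _ V`);
* `subsingleton_H_of_isAffine`, `subsingleton_H_of_isAffine_of_isQuasicoherent` — for `X` affine,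
  **`Hᵖ(X, M) = 0`** (Mathlib's `Sheaf.H`) for all `p > 0`.

This is The Stacks Project, Tag 01XB (Cohomology of Schemes, Lemma 30.2.2: "Let `X` be a scheme.
Let `𝓕` be a quasi-coherent `𝒪_X`-module. For any affine open `U ⊂ X` we have `Hᵖ(U, 𝓕) = 0` for
all `p > 0`."), Görtz–Wedhorn II Thm. 22.2, and — for Noetherian affine schemes — Hartshorne III
Thm. 3.5; the proof is the printed one of Tag 01XB: the Čech-to-cohomology criterion on a basis
stable under the coverings' fibre products (Tag 01EW / Tag 03F9 = the tree's Cartan criterion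
`subsingleton_ext_freeSheaf_of_cech_exactAt`, with `B` = affine opens and `Cov` = their standard
coverings `(D(g_a))_a`, `IsStandard`), fed with the vanishing of the Čech cohomology of `M` on
standard coverings of affine opens (Tag 01X9, `cechCochainComplex_exactAt_succ`), itself the
exactness of the Čech complex of a localizing system of modules
(`Algebra/Homology/CechLocalization.exists_cechD_eq`) applied to the sections
`Γ(D(g_{k₀}⋯g_{kₙ}), M) = Γ(V, M)_{g_{k₀}⋯g_{kₙ}}` (`isLocalizedModule_res_basicOpen`,
Hartshorne II Lemma 5.3) through the section model of the Čech complex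
(`Algebra/Homology/CechFiniteFamily`).

Contents: `SecBelow M h` (sections over `W ⊆ V` as `Γ(V, 𝒪_X)`-modules), `res` (linear
restriction), `isLocalizedModule_res_basicOpen`; `cechWidePullback_eq_iInf` (wide pullbacks of opens
are intersections), `basicOpen_finset_prod`, `IsStandard`, `isAffineOpen_cechWidePullback`,
`generate_mem_of_isStandard`, `exists_isStandard_of_mem` (every covering sieve of an affine open
contains a standard covering); `isSystem_sec`, `face_eq_res`, `ofSec_cechD`,
`cechCochainComplex_exactAt_succ`; the vanishing theorems.

## References

* The Stacks Project, Tag 01XB (Lemma 30.2.2), Tag 01X9 (Lemma 30.2.1), Tag 01EW (Cohomology,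
  Lemma 20.11.9), Tag 03F9 (Cohomology on Sites, Lemma 21.10.9) — tags read 2026-08-16.
  [StacksProject]
* U. Görtz, T. Wedhorn, *Algebraic Geometry II: Cohomology of Schemes*, Springer Spektrum (2023),
  doi:10.1007/978-3-658-43031-3: Lemma 22.1 (p. 327), Thm. 22.2 (p. 328). [GortzWedhorn2023]
* R. Hartshorne, *Algebraic Geometry*, GTM 52 (1977): III Thm. 3.5 (p. 215), II Lemma 5.3 (p. 112).
  [Hartshorne1977]

## Design notes

* Everything is proved; no named facts (D-0026).
* The abelian sheaf is `(SheafOfModules.toSheaf X.ringCatSheaf).obj M` (the tree's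
  `HodgeTheory.modulesToSheaf X`, by `rfl`; the form in which `Crystalline/DeRhamComplexHodgeSheaves`
  presents the terms of the de Rham complex); its sections and restriction maps are those of
  `M.presheaf`, definitionally.
* Universes: `X : Scheme.{u}`, coverings indexed in `Type u`, `Ext` in an arbitrary universe `w'`
  (`Sheaf (Opens.grothendieckTopology X) Ab.{u}` is Grothendieck abelian, so `HasExt.{u}` is the
  canonical instance, `Mathlib.CategoryTheory.Abelian.GrothendieckCategory.HasExt`).
* Mathlib searched (pin): `AlgebraicGeometry/Modules/Tilde` (`M~` on `Spec R`, no cohomology),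
  `CategoryTheory/Sites/SheafCohomology/*` (abstract `Sheaf.H`, Mayer–Vietoris, the Čech complex
  functor without comparison); no vanishing theorem for quasi-coherent cohomology. Used:
  `IsAffineOpen.exists_basicOpen_le`, `IsAffineOpen.iSup_basicOpen_eq_self_iff`,
  `IsAffineOpen.self_le_iSup_basicOpen_iff`, `IsAffineOpen.basicOpen`, `Scheme.basicOpen_mul`,
  `RingedSpace.isUnit_res_basicOpen`, `Submodule.mem_span_finite_of_mem_span`,
  `IsLocalizedModule.Away.mk_of_addCommGroup`, `Module.End.isUnit_iff`, `IsUnit.smul_bijective`,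
  `isTerminalTop`, `isAffineOpen_top`.
-/

noncomputable section

open CategoryTheory CategoryTheory.Limits CategoryTheory.Abelian AlgebraicGeometry TopologicalSpace Opposite
open Literature.Algebra.Homology

universe w' u

namespace Literature.AlgebraicGeometry.Modules

namespace AffineVanishing

variable {X : Scheme.{u}} (M : X.Modules)

/-! ### Sections over opens below `V` as `Γ(V, 𝒪_X)`-modules -/

/-- The sections `Γ(W, M)` of `M` over an open `W ⊆ V`, as a module over `Γ(V, 𝒪_X)` through the
restriction `Γ(V, 𝒪_X) → Γ(W, 𝒪_X)` (a type synonym carrying `Module.compHom`). [folklore] -/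
def SecBelow {V W : X.Opens} (_ : W ≤ V) : Type u := Γ(M, W)

/-- The additive group structure of `Γ(W, M)`. [folklore] -/
instance {V W : X.Opens} (h : W ≤ V) : AddCommGroup (SecBelow M h) :=
  inferInstanceAs (AddCommGroup Γ(M, W))

/-- `Γ(V, 𝒪_X)` acts on `Γ(W, M)` through the restriction `Γ(V, 𝒪_X) → Γ(W, 𝒪_X)`. [folklore] -/
instance {V W : X.Opens} (h : W ≤ V) : Module Γ(X, V) (SecBelow M h) :=
  Module.compHom Γ(M, W) (X.presheaf.map (homOfLE h).op).hom

/-- The identity `Γ(W, M) → SecBelow M h`. [folklore] -/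
def toSec {V W : X.Opens} (h : W ≤ V) (x : Γ(M, W)) : SecBelow M h := x

/-- The identity `SecBelow M h → Γ(W, M)`. [folklore] -/
def ofSec {V W : X.Opens} (h : W ≤ V) (x : SecBelow M h) : Γ(M, W) := x

/-- `ofSec ∘ toSec = id`. [folklore] -/
@[simp] theorem ofSec_toSec {V W : X.Opens} (h : W ≤ V) (x : Γ(M, W)) :
    ofSec M h (toSec M h x) = x := rfl

/-- `toSec ∘ ofSec = id`. [folklore] -/
@[simp] theorem toSec_ofSec {V W : X.Opens} (h : W ≤ V) (x : SecBelow M h) :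
    toSec M h (ofSec M h x) = x := rfl

/-- `toSec` is additive. [folklore] -/
theorem toSec_add {V W : X.Opens} (h : W ≤ V) (x y : Γ(M, W)) :
    toSec M h (x + y) = toSec M h x + toSec M h y := rfl

/-- `toSec 0 = 0`. [folklore] -/
@[simp] theorem toSec_zero {V W : X.Opens} (h : W ≤ V) : toSec M h (0 : Γ(M, W)) = 0 := rfl

/-- `ofSec 0 = 0`. [folklore] -/
@[simp] theorem ofSec_zero {V W : X.Opens} (h : W ≤ V) : ofSec M h (0 : SecBelow M h) = 0 := rfl

/-- `toSec` is injective (it is the identity). [folklore] -/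
theorem toSec_injective {V W : X.Opens} (h : W ≤ V) : Function.Injective (toSec M h) :=
  fun _ _ e => e

/-- The scalar action on `SecBelow M h`: `r • x = r|_W • x`. [folklore] -/
theorem smul_def {V W : X.Opens} (h : W ≤ V) (r : Γ(X, V)) (x : SecBelow M h) :
    r • x = toSec M h (X.presheaf.map (homOfLE h).op r • ofSec M h x) := rfl

/-- **Restriction `Γ(W, M) → Γ(W', M)` (`W' ⊆ W ⊆ V`) is `Γ(V, 𝒪_X)`-linear.** [folklore] -/
def res {V W W' : X.Opens} (h : W ≤ V) (h' : W' ≤ V) (hW : W' ≤ W) :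
    SecBelow M h →ₗ[Γ(X, V)] SecBelow M h' where
  toFun x := toSec M h' (M.presheaf.map (homOfLE hW).op (ofSec M h x))
  map_add' x y := by
    change toSec M h' (M.presheaf.map (homOfLE hW).op (ofSec M h x + ofSec M h y)) = _
    rw [map_add]
    rfl
  map_smul' r x := by
    rw [smul_def, ofSec_toSec, Scheme.Modules.map_smul, RingHom.id_apply, smul_def, ofSec_toSec]
    congr 2
    change (X.presheaf.map (homOfLE h).op ≫ X.presheaf.map (homOfLE hW).op) r = _
    rw [← X.presheaf.map_comp]
    rfl

/-- `res` on elements. [folklore] -/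
theorem ofSec_res {V W W' : X.Opens} (h : W ≤ V) (h' : W' ≤ V) (hW : W' ≤ W) (x : SecBelow M h) :
    ofSec M h' (res M h h' hW x) = M.presheaf.map (homOfLE hW).op (ofSec M h x) := rfl

/-- `res` on elements of `Γ(W, M)`. [folklore] -/
theorem res_toSec {V W W' : X.Opens} (h : W ≤ V) (h' : W' ≤ V) (hW : W' ≤ W) (x : Γ(M, W)) :
    res M h h' hW (toSec M h x) = toSec M h' (M.presheaf.map (homOfLE hW).op x) := rfl

/-- `res` composes. [folklore] -/
theorem res_res {V W W' W'' : X.Opens} (h : W ≤ V) (h' : W' ≤ V) (h'' : W'' ≤ V) (hW : W' ≤ W)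
    (hW' : W'' ≤ W') (x : SecBelow M h) :
    res M h' h'' hW' (res M h h' hW x) = res M h h'' (hW'.trans hW) x := by
  apply toSec_injective M h'' |>.eq_iff.mp ?_
  change toSec M h'' (M.presheaf.map (homOfLE hW').op (M.presheaf.map (homOfLE hW).op _)) =
    toSec M h'' (M.presheaf.map _ _)
  rw [← CategoryTheory.comp_apply, ← M.presheaf.map_comp]
  rfl

/-- `res` along equal opens composes to the identity-like map; in particular `res` from `W` to `W`
is the identity. [folklore] -/
theorem res_self {V W : X.Opens} (h : W ≤ V) (x : SecBelow M h) : res M h h le_rfl x = x := by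
  change toSec M h (M.presheaf.map (homOfLE le_rfl).op _) = _
  have : (homOfLE (le_rfl : W ≤ W)).op = 𝟙 (op W) := Subsingleton.elim _ _
  rw [this, M.presheaf.map_id]
  rfl

/-! ### Sections over a basic open `D(ρ) ⊆ V` of an affine `V` are the localization `Γ(V, M)_ρ` -/

/-- **`Γ(D(ρ), M) = Γ(V, M)_ρ` for `M` affine-localizing and `V` affine** (Hartshorne II Lemma 5.3 in
`IsLocalizedModule` form): the restriction `Γ(V, M) → Γ(W, M)`, `W = D(ρ)`, is a localization at the
powers of `ρ`. [cite: Hartshorne1977, II Lemma 5.3 p. 112 (PDF p. 141)] -/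
theorem isLocalizedModule_res_basicOpen (hM : IsAffineLocalizing M) {V W : X.Opens}
    (hV : IsAffineOpen V) (ρ : Γ(X, V)) (hW : W = X.basicOpen ρ) (hWV : W ≤ V) :
    IsLocalizedModule (Submonoid.powers ρ) (res M le_rfl hWV hWV) := by
  refine IsLocalizedModule.Away.mk_of_addCommGroup ?_ ?_ ?_
  · -- `ρ` acts through the unit `ρ|_{D(ρ)}`
    have hu : IsUnit (X.presheaf.map (homOfLE hWV).op ρ) := by
      subst hW
      exact X.toRingedSpace.isUnit_res_basicOpen ρ
    rw [Module.End.isUnit_iff]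
    have e : ⇑(algebraMap Γ(X, V) (Module.End Γ(X, V) (SecBelow M hWV)) ρ) =
        fun x : SecBelow M hWV => toSec M hWV (X.presheaf.map (homOfLE hWV).op ρ • ofSec M hWV x) := by
      funext x
      rfl
    rw [e]
    exact hu.smul_bijective (β := Γ(M, W))
  · intro s
    obtain ⟨n, x, hx⟩ := hM.numerator hV ρ hW (ofSec M hWV s)
    refine ⟨n, toSec M le_rfl x, ?_⟩
    rw [res_toSec, Subsingleton.elim (homOfLE hWV) (homOfLE (hW.trans_le (X.basicOpen_le ρ))), hx,
      ← map_pow, ← smul_def]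
  · intro x hx
    obtain ⟨n, hn⟩ := hM.torsion hV ρ (ofSec M le_rfl x) hWV (hW ▸ le_rfl)
      (congrArg (ofSec M hWV) hx)
    refine ⟨n, ?_⟩
    rw [smul_def]
    have : (homOfLE (le_rfl : V ≤ V)).op = 𝟙 (op V) := Subsingleton.elim _ _
    rw [this, X.presheaf.map_id, map_pow]
    exact congrArg (toSec M le_rfl) hn

/-! ### Wide pullbacks of opens, standard coverings of affine opens -/

/-- `X.Opens` has finite wide pullbacks (it is a complete lattice). [folklore] -/
instance : HasFiniteWidePullbacks X.Opens := inferInstance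

variable {V : X.Opens} (𝒱 : PreZeroHypercover.{u} V)

/-- The wide pullback of opens over `V` lies in `V`. [folklore] -/
theorem cechWidePullback_le_base {n : ℕ} (k : Fin (n + 1) → 𝒱.I₀) :
    (cechWidePullback 𝒱.f k : X.Opens) ≤ V :=
  (WidePullback.base fun a => 𝒱.f (k a)).le

/-- The wide pullback of opens lies in each member. [folklore] -/
theorem cechWidePullback_le {n : ℕ} (k : Fin (n + 1) → 𝒱.I₀) (a : Fin (n + 1)) :
    (cechWidePullback 𝒱.f k : X.Opens) ≤ 𝒱.X (k a) :=
  (WidePullback.π (fun a => 𝒱.f (k a)) a).le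

/-- Universal property of the wide pullback of opens. [folklore] -/
theorem le_cechWidePullback {n : ℕ} (k : Fin (n + 1) → 𝒱.I₀) {W : X.Opens} (hW : W ≤ V)
    (h : ∀ a, W ≤ 𝒱.X (k a)) : W ≤ cechWidePullback 𝒱.f k :=
  (WidePullback.lift (homOfLE hW) (fun a => homOfLE (h a)) fun _ => Subsingleton.elim _ _).le

/-- **The wide pullback of opens is the intersection** `V ∩ ⋂ₐ V_{kₐ}`. [folklore] -/
theorem cechWidePullback_eq_iInf {n : ℕ} (k : Fin (n + 1) → 𝒱.I₀) :
    (cechWidePullback 𝒱.f k : X.Opens) = V ⊓ ⨅ a, 𝒱.X (k a) :=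
  le_antisymm (le_inf (cechWidePullback_le_base 𝒱 k) (le_iInf (cechWidePullback_le 𝒱 k)))
    (le_cechWidePullback 𝒱 k inf_le_left fun a => inf_le_right.trans (iInf_le _ a))

/-- `D(∏ᵢ fᵢ) = V ∩ ⋂ᵢ D(fᵢ)` for a finite family of functions on `V`. [folklore] -/
theorem basicOpen_finset_prod {ι : Type*} (f : ι → Γ(X, V)) (s : Finset ι) :
    X.basicOpen (∏ i ∈ s, f i) = V ⊓ ⨅ i ∈ s, X.basicOpen (f i) := by
  classical
  induction s using Finset.induction_on with
  | empty =>
    simp only [Finset.prod_empty, Finset.notMem_empty, not_false_eq_true, iInf_neg, iInf_top,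
      le_top, inf_of_le_left]
    exact X.basicOpen_of_isUnit isUnit_one
  | insert a s ha ih =>
    rw [Finset.prod_insert ha, X.basicOpen_mul, ih, Finset.iInf_insert, ← inf_assoc,
      inf_comm (X.basicOpen (f a)) V, inf_assoc]

/-- `D(g_{k₀} ⋯ g_{kₙ}) = ⋂ₐ D(g_{kₐ})` (inside `V`). [folklore] -/
theorem basicOpen_gprod {A : Type u} (g : A → Γ(X, V)) {n : ℕ} (k : Fin (n + 1) → A) :
    X.basicOpen (CechLocalization.gprod g k) = V ⊓ ⨅ a, X.basicOpen (g (k a)) := by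
  unfold CechLocalization.gprod
  rw [basicOpen_finset_prod]
  congr 1
  simp only [Finset.mem_univ, iInf_pos]

/-- **Standard coverings**: the finite families of principal opens `(D(g_a))_{a ∈ A}` of an AFFINE open
`V`, `g_a ∈ Γ(V, 𝒪_X)` generating the unit ideal (the class `Cov` of Cartan's criterion).
[folklore] -/
structure IsStandard : Prop where
  /-- the base is affine -/
  isAffineOpen : IsAffineOpen V
  /-- finitely many members -/
  finite : Finite 𝒱.I₀
  /-- the members are the principal opens of functions generating the unit ideal -/
  exists_eq_basicOpen : ∃ g : 𝒱.I₀ → Γ(X, V),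
    (∀ i, 𝒱.X i = X.basicOpen (g i)) ∧ Ideal.span (Set.range g) = ⊤

/-- For a standard covering, the wide pullbacks are the principal opens `D(g_{k₀} ⋯ g_{kₙ})`.
[folklore] -/
theorem cechWidePullback_eq_basicOpen {g : 𝒱.I₀ → Γ(X, V)} (hg : ∀ i, 𝒱.X i = X.basicOpen (g i))
    {n : ℕ} (k : Fin (n + 1) → 𝒱.I₀) :
    (cechWidePullback 𝒱.f k : X.Opens) = X.basicOpen (CechLocalization.gprod g k) := by
  rw [cechWidePullback_eq_iInf, basicOpen_gprod]
  congr 1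
  exact iInf_congr fun a => hg (k a)

/-- The wide pullbacks of a standard covering are affine (hypothesis `hCovB` of Cartan's criterion).
[folklore] -/
theorem isAffineOpen_cechWidePullback (h𝒱 : IsStandard 𝒱) {n : ℕ} (k : Fin (n + 1) → 𝒱.I₀) :
    IsAffineOpen (cechWidePullback 𝒱.f k : X.Opens) := by
  obtain ⟨g, hg, -⟩ := h𝒱.exists_eq_basicOpen
  rw [cechWidePullback_eq_basicOpen 𝒱 hg]
  exact h𝒱.isAffineOpen.basicOpen _

/-- A standard covering covers (hypothesis `hCovJ` of Cartan's criterion). [folklore] -/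
theorem generate_mem_of_isStandard (h𝒱 : IsStandard 𝒱) :
    Sieve.generate (Presieve.ofArrows 𝒱.X 𝒱.f) ∈ Opens.grothendieckTopology X V := by
  obtain ⟨g, hg, hspan⟩ := h𝒱.exists_eq_basicOpen
  rw [Opens.mem_grothendieckTopology]
  intro x hx
  have hcov := (h𝒱.isAffineOpen.iSup_basicOpen_eq_self_iff (s := Set.range g)).mpr hspan
  have hx' : x ∈ ⨆ f : Set.range g, X.basicOpen (f : Γ(X, V)) := by rw [hcov]; exact hx
  obtain ⟨⟨_, ⟨i, rfl⟩⟩, hxi⟩ := Opens.mem_iSup.mp hx'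
  refine ⟨𝒱.X i, 𝒱.f i, Sieve.le_generate (Presieve.ofArrows 𝒱.X 𝒱.f) _ _ (Presieve.ofArrows.mk i), ?_⟩
  rw [hg i]
  exact hxi

/-- **Every covering sieve of an affine open contains a standard covering** (hypothesis `hBCov` of
Cartan's criterion): refine to principal opens (Mathlib `IsAffineOpen.exists_basicOpen_le`) and keep
finitely many whose functions generate the unit ideal. [folklore] -/
theorem exists_isStandard_of_mem (hV : IsAffineOpen V) (S₀ : Sieve V)
    (hS₀ : S₀ ∈ Opens.grothendieckTopology X V) :
    ∃ 𝒱 : PreZeroHypercover.{u} V, IsStandard 𝒱 ∧ ∀ i, S₀ (𝒱.f i) := by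
  classical
  rw [Opens.mem_grothendieckTopology] at hS₀
  -- a principal neighbourhood inside a member of the sieve, for every point of `V`
  have hpt : ∀ x : V, ∃ r : Γ(X, V), (∃ (U : X.Opens) (f : U ⟶ V), S₀ f ∧ X.basicOpen r ≤ U) ∧
      (x : X) ∈ X.basicOpen r := by
    intro x
    obtain ⟨U, f, hf, hxU⟩ := hS₀ x x.2
    obtain ⟨r, hrU, hxr⟩ := hV.exists_basicOpen_le ⟨(x : X), hxU⟩ x.2
    exact ⟨r, ⟨U, f, hf, hrU⟩, hxr⟩
  choose r hr hxr using hpt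
  -- the `r_x` generate the unit ideal, hence so do finitely many of them
  have hspan : Ideal.span (Set.range r) = ⊤ := by
    rw [← hV.self_le_iSup_basicOpen_iff]
    intro x hx
    exact Opens.mem_iSup.mpr ⟨⟨r ⟨x, hx⟩, ⟨⟨x, hx⟩, rfl⟩⟩, hxr ⟨x, hx⟩⟩
  obtain ⟨T, hT, h1⟩ := Submodule.mem_span_finite_of_mem_span
    ((Ideal.eq_top_iff_one _).mp hspan)
  refine ⟨⟨(T : Set Γ(X, V)), fun t => X.basicOpen (t : Γ(X, V)),
    fun t => homOfLE (X.basicOpen_le _)⟩, ⟨hV, inferInstance, Subtype.val, fun _ => rfl, ?_⟩, ?_⟩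
  · rw [Subtype.range_coe_subtype, Set.setOf_mem_eq]
    exact (Ideal.eq_top_iff_one _).mpr h1
  · rintro ⟨t, ht⟩
    obtain ⟨x, rfl⟩ := hT ht
    obtain ⟨U, f, hf, hrU⟩ := hr x
    have : (homOfLE (X.basicOpen_le (r x)) : X.basicOpen (r x) ⟶ V) = homOfLE hrU ≫ f :=
      Subsingleton.elim _ _
    show S₀ (homOfLE (X.basicOpen_le (r x)))
    rw [this]
    exact S₀.downward_closed hf _

/-! ### The Čech complex of an affine-localizing module on a standard covering is exact -/

section CechExact

variable (hM : IsAffineLocalizing M) {g : 𝒱.I₀ → Γ(X, V)}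
  (hg : ∀ i, 𝒱.X i = X.basicOpen (g i))

/-- The localizing system of sections of `M` over the wide pullbacks of `𝒱`. [folklore] -/
abbrev secSystem (m : ℕ) (kk : Fin (m + 1) → 𝒱.I₀) : Type u :=
  SecBelow M (cechWidePullback_le_base 𝒱 kk)

/-- Its structure maps: restriction from `V`. [folklore] -/
abbrev secι (m : ℕ) (kk : Fin (m + 1) → 𝒱.I₀) :
    SecBelow M (le_rfl : V ≤ V) →ₗ[Γ(X, V)] secSystem M 𝒱 m kk :=
  res M le_rfl (cechWidePullback_le_base 𝒱 kk) (cechWidePullback_le_base 𝒱 kk)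

include hM hg in
/-- **The sections of `M` over the wide pullbacks of a standard covering of an affine `V` form a
localizing system** (`Algebra/Homology/CechLocalization`) for `(g_a)` with twist `1`. [folklore] -/
theorem isSystem_sec (hV : IsAffineOpen V) :
    CechLocalization.IsSystem g 1 (secSystem M 𝒱) (secι M 𝒱) := by
  refine ⟨fun m kk => ?_⟩
  change IsLocalizedModule (Submonoid.powers (1 * CechLocalization.gprod g kk)) _
  rw [one_mul]
  exact isLocalizedModule_res_basicOpen M hM hV _ (cechWidePullback_eq_basicOpen 𝒱 hg kk) _

variable (hL : CechLocalization.IsSystem g 1 (secSystem M 𝒱) (secι M 𝒱))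

/-- The faces of the localizing system are the restriction maps of `M`. [folklore] -/
theorem face_eq_res {n : ℕ} (kk : Fin (n + 2) → 𝒱.I₀) (i : Fin (n + 2)) :
    CechLocalization.face hL kk i =
      res M (cechWidePullback_le_base 𝒱 (CechLocalization.faceIdx kk i))
        (cechWidePullback_le_base 𝒱 kk) (CechFamily.cechδ 𝒱.f kk i).le := by
  symm
  refine CechLocalization.transfer_unique hL _ _ _ _ ?_
  apply LinearMap.ext
  intro x
  exact res_res M _ _ _ _ _ x

/-- `ofSec` as an additive map. [folklore] -/
def ofSecHom {W : X.Opens} (h : W ≤ V) : SecBelow M h →+ Γ(M, W) where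
  toFun := ofSec M h
  map_zero' := rfl
  map_add' _ _ := rfl

/-- `ofSec` commutes with finite sums. [folklore] -/
theorem ofSec_sum {W : X.Opens} (h : W ≤ V) {ι : Type*} (t : Finset ι) (f : ι → SecBelow M h) :
    ofSec M h (∑ i ∈ t, f i) = ∑ i ∈ t, ofSec M h (f i) :=
  map_sum (ofSecHom M h) f t

/-- `ofSec` commutes with integer multiples. [folklore] -/
theorem ofSec_zsmul {W : X.Opens} (h : W ≤ V) (n : ℤ) (x : SecBelow M h) :
    ofSec M h (n • x) = n • ofSec M h x :=
  map_zsmul (ofSecHom M h) n x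

/-- **The Čech differential of the localizing system is the Čech differential of the sheaf** (section
model of `Algebra/Homology/CechFiniteFamily`). [folklore] -/
theorem ofSec_cechD (m : ℕ) (c : CechLocalization.Cochain (secSystem M 𝒱) m)
    (kk : Fin (m + 2) → 𝒱.I₀) :
    ofSec M _ (CechLocalization.cechD hL m c kk) =
      CechFamily.cechD 𝒱.f M.presheaf m (fun kk => ofSec M _ (c kk)) kk := by
  rw [CechLocalization.cechD_apply, ofSec_sum]
  unfold CechFamily.cechD
  refine Finset.sum_congr rfl fun i _ => ?_
  rw [ofSec_zsmul]
  congr 1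
  rw [face_eq_res M 𝒱 hL kk i, ofSec_res]
  rfl

include hM hg in
/-- **The Čech complex `Č•(𝒱, M)` of an affine-localizing module on a standard covering of an affine
open is exact in positive degrees** (The Stacks Project, Tag 01X9; Görtz–Wedhorn II Lemma 22.1),
for the Čech complex `Hom(ℤ[N(𝒱)]_•, M)` of `Algebra/Homology/CechNerve` consumed by Cartan's
criterion. [cite: StacksProject, Tag 01X9] [cite: GortzWedhorn2023, Lemma 22.1 p. 327] -/
theorem cechCochainComplex_exactAt_succ (hV : IsAffineOpen V) [Finite 𝒱.I₀]
    (hspan : Ideal.span (Set.range g) = ⊤) (n : ℕ) :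
    (cechCochainComplex 𝒱.f ((SheafOfModules.toSheaf X.ringCatSheaf).obj M).obj).ExactAt (n + 1) := by
  have hL := isSystem_sec M 𝒱 hM hg hV
  change (cechCochainComplex 𝒱.f M.presheaf).ExactAt (n + 1)
  rw [CechFamily.cechCochainComplex_exactAt_succ_iff_sections]
  intro s hs
  let c : CechLocalization.Cochain (secSystem M 𝒱) (n + 1) := fun kk => toSec M _ (s kk)
  have hc : CechLocalization.cechD hL (n + 1) c = 0 := by
    funext kk
    have h1 := ofSec_cechD M 𝒱 hL (n + 1) c kk
    have h2 : CechFamily.cechD 𝒱.f M.presheaf (n + 1)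
        (fun kk => ofSec M (cechWidePullback_le_base 𝒱 kk) (c kk)) kk = 0 := congrFun hs kk
    exact h1.trans h2
  obtain ⟨b, hb⟩ := CechLocalization.exists_cechD_eq hspan hL n c hc
  refine ⟨fun kk => ofSec M _ (b kk), funext fun kk => ?_⟩
  rw [← ofSec_cechD M 𝒱 hL, hb]
  rfl

end CechExact

/-! ### Serre's vanishing theorem -/

section Vanishing

variable [HasExt.{w'} (Sheaf (Opens.grothendieckTopology X) AddCommGrpCat.{u})]

/-- **Serre's vanishing theorem on affine opens** (The Stacks Project, Tag 01XB = Cohomology of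
Schemes, Lemma 30.2.2: "Let `X` be a scheme. Let `𝓕` be a quasi-coherent `𝒪_X`-module. For any
affine open `U ⊂ X` we have `Hᵖ(U, 𝓕) = 0` for all `p > 0`"; Görtz–Wedhorn II Thm. 22.2;
Hartshorne III Thm. 3.5 for Noetherian affine schemes), for affine-localizing (e.g. quasi-coherent,
`IsAffineLocalizing.of_isQuasicoherent`) modules `M`, with `Hᵖ(V, M) = Extᵖ(ℤ[h_V], M)` the
cohomology of the open `V` computed on the site of `X` (`Algebra/Homology/CartanCriterion`).
Proof as in Tag 01XB: Cartan's criterion (Tag 01EW / 03F9, the tree's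
`subsingleton_ext_freeSheaf_of_cech_exactAt`) for the class of affine opens and their standard
coverings, whose Čech complexes are exact by Tag 01X9 (`cechCochainComplex_exactAt_succ`).
[cite: StacksProject, Tag 01XB] [cite: GortzWedhorn2023, Thm. 22.2 p. 328]
[cite: Hartshorne1977, III Thm. 3.5] -/
theorem subsingleton_ext_freeSheaf_of_isAffineOpen (hM : IsAffineLocalizing M) {V : X.Opens}
    (hV : IsAffineOpen V) (n : ℕ) :
    Subsingleton (Ext.{w'} (freeSheaf.{u} (Opens.grothendieckTopology X) V)
      ((SheafOfModules.toSheaf X.ringCatSheaf).obj M) (n + 1)) :=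
  subsingleton_ext_freeSheaf_of_cech_exactAt (J := Opens.grothendieckTopology X)
    (fun W : X.Opens => IsAffineOpen W) (fun _ 𝒱 => IsStandard 𝒱)
    (fun _ 𝒱 h _ k => isAffineOpen_cechWidePullback 𝒱 h k)
    (fun _ 𝒱 h => generate_mem_of_isStandard 𝒱 h)
    (fun _ hW S₀ hS₀ => exists_isStandard_of_mem hW S₀ hS₀)
    ((SheafOfModules.toSheaf X.ringCatSheaf).obj M)
    (fun _ 𝒱 h n => by
      obtain ⟨g, hg, hspan⟩ := h.exists_eq_basicOpen
      haveI := h.finite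
      exact cechCochainComplex_exactAt_succ M 𝒱 hM hg h.isAffineOpen hspan n)
    hV n

/-- **Serre's vanishing theorem for affine schemes**: `Hᵖ(X, M) = 0` (Mathlib's `Sheaf.H` of the
underlying abelian sheaf) for `p > 0`, `X` affine and `M` affine-localizing (e.g. quasi-coherent).
[cite: StacksProject, Tag 01XB] [cite: GortzWedhorn2023, Thm. 22.2 p. 328]
[cite: Hartshorne1977, III Thm. 3.5] -/
theorem subsingleton_H_of_isAffine [IsAffine X] (hM : IsAffineLocalizing M) (n : ℕ) :
    Subsingleton (Sheaf.H.{w'} ((SheafOfModules.toSheaf X.ringCatSheaf).obj M) (n + 1)) :=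
  subsingleton_sheafH_of_cech_exactAt (J := Opens.grothendieckTopology X)
    (fun W : X.Opens => IsAffineOpen W) (fun _ 𝒱 => IsStandard 𝒱)
    (fun _ 𝒱 h _ k => isAffineOpen_cechWidePullback 𝒱 h k)
    (fun _ 𝒱 h => generate_mem_of_isStandard 𝒱 h)
    (fun _ hW S₀ hS₀ => exists_isStandard_of_mem hW S₀ hS₀)
    ((SheafOfModules.toSheaf X.ringCatSheaf).obj M)
    (fun _ 𝒱 h n => by
      obtain ⟨g, hg, hspan⟩ := h.exists_eq_basicOpen
      haveI := h.finite
      exact cechCochainComplex_exactAt_succ M 𝒱 hM hg h.isAffineOpen hspan n)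
    isTerminalTop (isAffineOpen_top X) n

/-- The same for quasi-coherent modules (`IsAffineLocalizing.of_isQuasicoherent`). [cite: StacksProject, Tag 01XB] -/
theorem subsingleton_H_of_isAffine_of_isQuasicoherent [IsAffine X] [M.IsQuasicoherent] (n : ℕ) :
    Subsingleton (Sheaf.H.{w'} ((SheafOfModules.toSheaf X.ringCatSheaf).obj M) (n + 1)) :=
  subsingleton_H_of_isAffine M (IsAffineLocalizing.of_isQuasicoherent M) n

end Vanishing

end AffineVanishing

end Literature.AlgebraicGeometry.Modules

end
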